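import Summits.ABC.IUTFork.LDHTensor
import Literature.IUT.LogVolume.TensorPacketMShellTame
import HarnessLib

/-!
# The fork at [IUTchIII] Corollary 3.12, L-DH level (c312-3), II-g: in Dupuy–Hilado's OWN shell normalisation the
# SHARP (Ind3)-datum `O_𝕃(−P_Θ)` EXISTS at every TAME prime (complement of R7-C3-Q1's "NO at wild tuples")

Record-only file (D-0012) of the abc-iut cell (Cor. 3.12 sub-crew, seat abc-iut-c312-3; wave-2 row W2-G follow-up
(iii); planner ruling R6-a: "BOTH normalisations stay typed and named"); TAKES NO SIDE. Dupuy–Hilado,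
arXiv:2004.13228 (pre-split text) §4 intro ("`I_{v̲} = (1/2p_{v̲}) log(O^×_{v̲})`"), §4.10 (the (Ind3)-bound
"`(O_𝕃(−P_Θ))^{Ind3} ⊆ … (q̲^{j²}_{v̲})^ℕ · Peel^j_{v̲} I^{⊗ j+1}_{V̲}`" [display's exponent `j²/2l` on `q̲` read as
`j²`, per DH §3.3 / Rmk. 3.9.1 — DH-internal wobble, cf. ref/REFEREE-PASS-B9 B9-3]); [IUTchIV] Prop. 1.2 (i)/(ii),
kurims p. 10 ("if `p > 2` and `e_i ≤ p − 2`, then `a_i = 1/e_i = −b_i`").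

THE RECORD. `LDHTensor.lean` builds, from the ideles ALONE, the minimal datum `minimalDHDatumM` in MOCHIZUKI's
normalisation (container `p^{−⌈d_I+a_I⌉}·log_p(R_I^×)`), and leaves the region of the Dupuy–Hilado-normalised
`realDHDatum` as an INPUT, because at WILDLY ramified tuples no (Ind3)-datum with shell `I_{v⃗}` exists (cell
question R7-C3-Q1, answered NO by exact computation, HOME/plan/c312/R7C3Q1-COMPUTATION.md: `ℚ_3(∛3)`,
`ℚ_3(ζ_9)⁺`, `ℚ_2(ζ_8)`). THIS FILE records the complementary POSITIVE half in the kernel: at a prime `p > 2` over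
which every `K_{v̲}` is TAMELY ramified with `e ≤ p − 2`, the two shells COINCIDE
(`TensorPacketMShellTame.mShell_eq_logShell_of_tame`: `d_i + a_i = 1`), so the SHARP datum
`(O_𝕃(−P_Θ))^{Ind3} := O_𝕃(−P_Θ)` satisfies Dupuy–Hilado's (4.10)-shaped bound in THEIR normalisation too:
`exists_sharp_realDHDatum_of_tame` — a `realDHDatum` (abc-iut-c312-3 gen 2's constructor: admissibility of
`hull(U_Θ)_p` PROVED) with `bare3 = O_𝕃(−P_Θ)_p`, from the ideles alone. So the two named normalisations of the
cell differ EXACTLY at wild tuples (and, at `p = 2`, at ramified ones).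
[cite: DupuyHilado2025, §4 (intro), §4.10] [cite: Mochizuki2012, IUTchIV Prop. 1.2 (i)(ii) p. 10]
[claim: Mochizuki2012, status: disputed] Nothing here says which normalisation [IUTchIII] Thm. 3.11 (ii) (Ind3) means,
nor takes a side on Cor. 3.12; an instance ≠ an endorsement.
-/

noncomputable section

open Set

namespace Literature.IUT.LogVolume

open NumberField IsDedekindDomain
open scoped Pointwise

namespace PrimePacket

variable {F : Type} [Field F] [NumberField F] {p : ℕ} [Fact p.Prime] (𝔽 : LocalFields F p) (X : PilotData F)

/-- **At a tame prime the SHARP Dupuy–Hilado datum exists from the ideles alone**: for `p > 2` with every `K_{v̲}`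
(`v | p`) of ramification index `≤ p − 2`, and ideles `t_Θ`, `t_q` with the printed valuations, there is a datum of
`DHData` at `p` over the Dupuy–Hilado-normalised real packet `realPrimePacket p 𝔽` (shell `I_{v⃗} =
(2p)^{−|I|}·log_p(R_I^×)`) whose (Ind3)-region IS the bare region `O_𝕃(−P_Θ)_p` — built by `realDHDatum` (so
`hull(U_Θ)_p` admissible, PROVED there), the (4.10)-shaped bound by `realPrimePacket_peel_O_subset_iUnion_shell_of_tame`.
[cite: DupuyHilado2025, §4.10] [cite: Mochizuki2012, IUTchIV Prop. 1.2 (ii) p. 10] -/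
theorem exists_sharp_realDHDatum_of_tame (hp : 2 < p)
    (he : ∀ v : placesOver F p, absRamificationIdx p (𝔽.k v) ≤ p - 2)
    (tΘ : Fin X.lstar → (v : placesOver F p) → (𝔽.k v)ˣ)
    (tΘ_ord : ∀ (i : Fin X.lstar) (v : placesOver F p), 𝔽.ordv (tΘ i v) = X.thetaPilot i v.1)
    (tq : Fin X.lstar → (v : placesOver F p) → (𝔽.k v)ˣ)
    (tq_ord : ∀ (i : Fin X.lstar) (v : placesOver F p), 𝔽.ordv (tq i v) = X.qPilot v.1) :
    ∃ d : (realPrimePacket p 𝔽).DHDatum X,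
      d.tΘ = tΘ ∧ d.tq = tq ∧ d.bare3 = (realPrimePacket p 𝔽).regionOf tΘ := by
  refine ⟨realDHDatum 𝔽 X tΘ tΘ_ord tq tq_ord ((realPrimePacket p 𝔽).regionOf tΘ) (fun j e => ?_)
    (fun _ _ => le_rfl) (fun i e => ?_) (fun j e => ?_), rfl, rfl, rfl⟩
  · -- admissible: a nondegenerate translate of `(R_I)^∼`
    obtain ⟨g, hg, hreg⟩ := exists_regionOf_eq_smul 𝔽 (fun j _ => shellScalar p (I := Fin (j + 1)))
      (fun _ _ => shellScalar_ne_zero p) (fun _ _ _ => rfl) tΘ j e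
    rw [show (realPrimePacket p 𝔽).regionOf tΘ j e = _ from hreg]
    exact packetAdm_smul_normalizedPacket p (fun i => 𝔽.k (e i)) g hg
  · -- the (4.10)-shaped bound, in Dupuy–Hilado's normalisation, at a tame tuple
    have h : 0 < (i : ℕ) + 1 ∧ (i : ℕ) + 1 - 1 < X.lstar := ⟨Nat.succ_pos _, by have := i.2; omega⟩
    have hfin : (⟨(i : ℕ) + 1 - 1, h.2⟩ : Fin X.lstar) = i := Fin.ext (by simp)
    have hreg : (realPrimePacket p 𝔽).regionOf tΘ ((i : ℕ) + 1) e =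
        (realPrimePacket p 𝔽).peel (tΘ i (e (Fin.last _))) '' (realPrimePacket p 𝔽).O ((i : ℕ) + 1) e := by
      unfold PrimePacket.regionOf
      rw [dif_pos h, hfin]
    rw [hreg]
    exact realPrimePacket_peel_O_subset_iUnion_shell_of_tame p 𝔽 hp i e (fun a => he (e a)) (tΘ i (e (Fin.last _)))
  · -- bounded: a translate of `(R_I)^∼`
    obtain ⟨g, _, hreg⟩ := exists_regionOf_eq_smul 𝔽 (fun j _ => shellScalar p (I := Fin (j + 1)))
      (fun _ _ => shellScalar_ne_zero p) (fun _ _ _ => rfl) tΘ j e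
    rw [show (realPrimePacket p 𝔽).regionOf tΘ j e = _ from hreg]
    exact isPsiBounded_smul_normalizedPacket p (fun i => 𝔽.k (e i)) g

end PrimePacket

end Literature.IUT.LogVolume

end
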